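import Summits.SmoothPoincare4.SmoothPoincare4.Theses.EntropyRung
import Summits.SmoothPoincare4.SmoothPoincare4.Theorems.EntropyRungSubcylindricalRecognitionSingularFlow
import Summits.SmoothPoincare4.SmoothPoincare4.Theorems.EntropyRungSubcylindricalRecognitionPointPicking
import Summits.SmoothPoincare4.SmoothPoincare4.Theorems.EntropyRungSubcylindricalRecognitionRescaledSequence
import Summits.SmoothPoincare4.SmoothPoincare4.Theorems.EntropyRungSubcylindricalRecognitionCompactModelRecognition
import Summits.SmoothPoincare4.SmoothPoincare4.Theorems.EntropyRungSubcylindricalRecognitionRenormalise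
import Summits.SmoothPoincare4.SmoothPoincare4.Theorems.EntropyRungSubcylindricalRecognitionConeHelpers
import Summits.SmoothPoincare4.SmoothPoincare4.Theorems.EntropyRungSubcylindricalRecognitionConeAnnulusArithmetic
import Summits.SmoothPoincare4.SmoothPoincare4.Theorems.EntropyRungSubcylindricalRecognitionConeCore
import Summits.SmoothPoincare4.SmoothPoincare4.Theorems.EntropyRungSubcylindricalRecognitionInjOnVolumeComparison
import Literature.Geometry.Riemannian.BamlerTangentFlowAtInfinity
import Literature.Geometry.Riemannian.PerelmanEntropyScaling
import Literature.Geometry.Riemannian.MetricTraceScaling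
import Literature.Geometry.Riemannian.RicciFlowScaling
import Literature.Geometry.Riemannian.RicciFlowScalarCurvatureHolds
import Literature.Topology.FourManifolds.HomotopyS4CompactProofs
import HarnessLib

/-!
# `EntropyRung.RecognitionOfShrinkerGaps` (stmt-SmoothPoincare4-14742), conditional closure

The glue item `RecognitionOfShrinkerGaps : NoncompactShrinkerGap → CompactShrinkerGap →
SubcylindricalRecognition` of route `EntropyRung` (Summits/SmoothPoincare4) is the composition
`SubcylindricalRecognition_of h₂ h₄` of the picked line `ancient-sphere-rigidity` of the crux
`SubcylindricalRecognition` (stmt-SmoothPoincare4-10869), read as an implication. This file assembles it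
from the line's landed stubs (namespace
`Summit.SmoothPoincare4.SmoothPoincare4.Theorems.SubcylindricalRecognition.AncientSphereRigidity`:
`stub_singularFlow_of`, `stub_pointPicking`, `stub_rescaledSequence`, `stub_renormalise`,
`stub_compactModelRecognition`, `coneCore`, `stub_injOnVolumeComparison`, `stub_coneAnnulusArithmetic`,
helpers of `ConeHelpers`),
CONDITIONALLY on the three named published facts the line rests on:

* F1 `Literature.Geometry.Riemannian.ricciFlow_shortTime_existence` (Hamilton 1982, Thm. 4.2),
* F2 `Literature.Geometry.Riemannian.perelman_muEntropy_monotone` (Perelman 2002, (3.4); Topping 2006, (8.3.10)),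
* N1 `Literature.Geometry.Riemannian.bamler_orbifoldTangentFlowAtInfinity_four` (Bamler 2020a Prop. 5.2,
  Thm. 10.1; 2020b; 2020c Thms. 2.4, 2.9, 2.16, 2.40, 2.46).

Deciding theorem: `recognitionOfShrinkerGaps_of_facts : F1 → F2 → N1 → RecognitionOfShrinkerGaps`
(`proof.conditional`; the item closes only when the three `_holds` exist or the facts are itemised).
-/

noncomputable section

open scoped Manifold ContDiff Topology ENNReal NNReal ContinuousMap
open Set MeasureTheory Filter
open Literature.Geometry.Lorentzian Literature.Geometry.Riemannian
open Summit.SmoothPoincare4.SmoothPoincare4.Theorems.SubcylindricalRecognition.AncientSphereRigidity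

namespace Summit.SmoothPoincare4.SmoothPoincare4.Theorems

namespace RecognitionOfShrinkerGaps

-- a ≈ 230-line assembly meeting statements elaborated in five other files (`N1`, `coneCore`, …): slightly
-- over the default budget, passes at 2× (the line's monolithic skeleton r6 compiled the same text in-file)
set_option maxHeartbeats 400000 in
/-- **The blow-down shrinker, from N1** (the line's `stub_blowdown`): for a non-collapsed sequence of
compact 4-dimensional Ricci flows on `[-A_k, 0]`, `A_k ≥ k`, `|Rm| ≤ 1`, with a non-flat anchor and the floor
`μ ≥ ν_cyl + δ'`, there is a complete connected smooth normalised gradient shrinker `(S, gS, fS)`,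
`Ric + Hess fS = gS/2`, `R + |∇fS|² = fS`, `R ≢ 0`, of Gaussian mass `> 32π²√π e^{-3/2}`, immersing
injectively into `M` when compact. Run N1 with `F = ν_cyl + δ'`; a cone point of order `k ≥ 2` is excluded
on the COMPACT approximants: transplant a sub-annulus of its orbifold chart into a rescaled slice `Q g_k(t)`
and bound `μ(Q g_k(t), τ) < ν_cyl + δ'` by the Gaussian annulus test function (`coneCore`,
`stub_injOnVolumeComparison`, `stub_coneAnnulusArithmetic`, `-log k < ν_cyl + δ'`), against the floor
`μ(Q g_k(t), τ) = μ(g_k(t), τ/Q) ≥ ν_cyl + δ'`; then renormalise `fS = f - W` (`stub_renormalise`).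
[cite: Bamler2020Structure, §2.4 Thm 2.16; §2.10 Thm 2.46] [cite: CarrilloNi2009, Thm. 1.1 (i)] -/
theorem blowdown_of (hN1 : bamler_orbifoldTangentFlowAtInfinity_four) :
    ∀ (M : Type) [TopologicalSpace M] [T2Space M] [SecondCountableTopology M]
      [ChartedSpace (EuclideanSpace ℝ (Fin 4)) M] [IsManifold (𝓡 4) ∞ M] [CompactSpace M]
      [ConnectedSpace M] [T3Space M] [MeasurableSpace M] [BorelSpace M]
      (A : ℕ → ℝ)
      (gk : ℕ → ℝ → PseudoRiemannianMetric (𝓡 4) ∞ (EuclideanSpace ℝ (Fin 4)) (TangentSpace (𝓡 4) : M → Type _))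
      (covk : ℕ → ℝ → CovariantDerivative (𝓡 4) (EuclideanSpace ℝ (Fin 4)) (TangentSpace (𝓡 4) : M → Type _))
      (xk : ℕ → M) (δ' c : ℝ), 0 < δ' → 0 < c →
      (∀ k : ℕ, (k : ℝ) ≤ A k) →
      (∀ k, IsRicciFlow (gk k) (covk k) (Set.Icc (-(A k)) 0)) →
      (∀ k, ∀ t ∈ Set.Icc (-(A k)) 0, (gk k t).IsRiemannian) →
      (∀ k, ∀ t ∈ Set.Icc (-(A k)) 0, CurvatureBoundedBy (gk k t) (covk k t) 1) →
      (∀ k, ∃ X Y Z W : TangentSpace (𝓡 4) (xk k),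
        (gk k 0).val (xk k) X X ≤ 1 ∧ (gk k 0).val (xk k) Y Y ≤ 1 ∧
        (gk k 0).val (xk k) Z Z ≤ 1 ∧ (gk k 0).val (xk k) W W ≤ 1 ∧
        c ≤ |(gk k 0).curvatureForm (covk k 0) (xk k) X Y Z W|) →
      (∀ k, ∀ t ∈ Set.Icc (-(A k)) 0, ∀ τ : ℝ, 0 < τ →
        ((Real.log 2 + Real.log Real.pi / 2 - 3 / 2 + δ' : ℝ) : EReal) ≤
          (gk k t).muEntropy (covk k t) τ) →
      ∃ (S : Type) (_ : TopologicalSpace S) (_ : T2Space S) (_ : SecondCountableTopology S)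
        (_ : ChartedSpace (EuclideanSpace ℝ (Fin 4)) S) (_ : IsManifold (𝓡 4) ∞ S) (_ : ConnectedSpace S)
        (_ : T3Space S) (_ : MeasurableSpace S) (_ : BorelSpace S)
        (gS : PseudoRiemannianMetric (𝓡 4) ∞ (EuclideanSpace ℝ (Fin 4)) (TangentSpace (𝓡 4) : S → Type _))
        (_ : gS.HasLeviCivita) (fS : S → ℝ) (hS : gS.IsRiemannian),
        (∀ (x : S) (r : NNReal), IsCompact {y : S | gS.edist hS x y ≤ r}) ∧
        ContMDiff (𝓡 4) 𝓘(ℝ, ℝ) ∞ fS ∧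
        (∀ (x : S) (X Y : TangentSpace (𝓡 4) x),
          gS.ricci x X Y + gS.hessian fS x X Y = (1 / 2 : ℝ) * gS.val x X Y) ∧
        (∀ x : S, gS.scalarCurvature x + gS.gradSq fS x = fS x) ∧
        (∃ x : S, gS.scalarCurvature x ≠ 0) ∧
        ENNReal.ofReal (32 * Real.pi ^ 2 * Real.sqrt Real.pi * Real.exp (-(3 : ℝ) / 2)) <
          ∫⁻ x, ENNReal.ofReal (Real.exp (-fS x))
            ∂(riemannianMeasure (gS.toContMDiffRiemannianMetric hS)) ∧
        (CompactSpace S → ∃ φ : S → M, ContMDiff (𝓡 4) (𝓡 4) ∞ φ ∧ Function.Injective φ ∧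
          ∀ x : S, Function.Injective (mfderiv (𝓡 4) (𝓡 4) φ x)) := by
  intro M _ _ _ _ _ _ _ _ _ _ A gk covk xk δ' c hδ' hc hA hflow hRiem hcurv hpt hfloor
  obtain ⟨S, i1, i2, i3, i4, i5, i7, i8, i9, gS, iLC, f, hS, W, ι, kc, rc, Λc, gc, hf, hsol, hnorm,
      hprob, hFW, -, hdich, hcone, htrans, hconn, hcompl, hcouple⟩ :=
    hN1 M A gk covk xk (Real.log 2 + Real.log Real.pi / 2 - 3 / 2 + δ') c hc hA hflow hRiem hcurv hpt
      hfloor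
  by_cases hι : Nonempty ι
  · -- ### a cone point leads to a contradiction with the entropy floor
    exfalso
    obtain ⟨i⟩ := hι
    obtain ⟨hk2, hrpos, hΛnn, hgcs, hgc0, -, -⟩ := hcone i
    have hk1 : 1 ≤ kc i := le_trans (by norm_num) hk2
    obtain ⟨m, hm⟩ : ∃ m : ℝ, m = Real.log 2 + Real.log Real.pi / 2 - 3 / 2 + δ' := ⟨_, rfl⟩
    have hmk : -Real.log (kc i) < m := hm ▸ neg_log_lt_nuCyl_add hk2 hδ'
    obtain ⟨η₀, hη₀, c₀, hc₀, harith⟩ := stub_coneAnnulusArithmetic (kc i) hk1 m hmk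
    obtain ⟨η, hηdef⟩ : ∃ η : ℝ, η = min η₀ (1 / 2) := ⟨_, rfl⟩
    have hηpos : 0 < η := hηdef ▸ lt_min hη₀ (by norm_num)
    have hηle : η ≤ η₀ := hηdef ▸ min_le_left _ _
    have hηhalf : η ≤ 1 / 2 := hηdef ▸ min_le_right _ _
    have hη1 : η < 1 := by linarith only [hηhalf]
    have hθpos : 0 < η / 3 := by positivity
    obtain ⟨r₁, hr₁, hr₁r, hgcmp⟩ :=
      exists_ball_sq_norm_comparison hrpos hθpos hgcs.continuousOn hgc0
    have hΛ1 : 0 < Λc i + 1 := by linarith only [hΛnn]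
    obtain ⟨τ, hτdef⟩ : ∃ τ : ℝ, τ = min (c₀ / (Λc i + 1)) (c₀ * r₁ ^ 2) / 2 := ⟨_, rfl⟩
    have hq1 : 0 < c₀ / (Λc i + 1) := div_pos hc₀ hΛ1
    have hq2 : 0 < c₀ * r₁ ^ 2 := by positivity
    have hτpos : 0 < τ := by rw [hτdef]; exact div_pos (lt_min hq1 hq2) two_pos
    have hτ1 : τ ≤ c₀ / (Λc i + 1) := by
      have := min_le_left (c₀ / (Λc i + 1)) (c₀ * r₁ ^ 2)
      rw [hτdef]; linarith only [this, hq1]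
    have hτ2 : τ ≤ c₀ * r₁ ^ 2 := by
      have := min_le_right (c₀ / (Λc i + 1)) (c₀ * r₁ ^ 2)
      rw [hτdef]; linarith only [this, hq2]
    have hΛτ : Λc i * τ ≤ c₀ := by
      calc Λc i * τ ≤ Λc i * (c₀ / (Λc i + 1)) := mul_le_mul_of_nonneg_left hτ1 hΛnn
        _ ≤ (Λc i + 1) * (c₀ / (Λc i + 1)) :=
            mul_le_mul_of_nonneg_right (by linarith only) hq1.le
        _ = c₀ := by field_simp
    obtain ⟨ε, hεdef⟩ : ∃ ε : ℝ, ε = min (Real.sqrt (c₀ * τ)) r₁ / 2 := ⟨_, rfl⟩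
    have hsqrtpos : 0 < Real.sqrt (c₀ * τ) := Real.sqrt_pos.mpr (by positivity)
    have hεpos : 0 < ε := by rw [hεdef]; exact div_pos (lt_min hsqrtpos hr₁) two_pos
    have hεr₁ : ε ≤ r₁ / 2 := by
      have := min_le_right (Real.sqrt (c₀ * τ)) r₁
      rw [hεdef]; linarith only [this]
    have hεsq : ε ^ 2 ≤ c₀ * τ := by
      have h1 : ε ≤ Real.sqrt (c₀ * τ) / 2 := by
        have := min_le_left (Real.sqrt (c₀ * τ)) r₁
        rw [hεdef]; linarith only [this]
      have h2 : ε ^ 2 ≤ (Real.sqrt (c₀ * τ) / 2) ^ 2 := pow_le_pow_left₀ hεpos.le h1 2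
      have h3 : (Real.sqrt (c₀ * τ) / 2) ^ 2 = c₀ * τ / 4 := by
        rw [div_pow, Real.sq_sqrt (by positivity)]; norm_num
      have h4 : 0 ≤ c₀ * τ := by positivity
      linarith only [h2, h3, h4]
    have hεlt : ε < rc i := by linarith only [hεr₁, hr₁r, hr₁]
    have hεr₁' : 8 * ε ^ 2 < 3 * r₁ ^ 2 := by nlinarith only [hεr₁, hεpos, hr₁]
    -- transplant an annulus of the cone chart into a rescaled slice of the compact flows
    obtain ⟨kₓ, t, ht, Q, hQ, Φ, ρ, hΦs, hopen, hmf, hfib, hρs, hdesc, hcmp, hRb⟩ :=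
      htrans i ε (η / 3) hεpos hεlt hθpos
    obtain ⟨Abig, hAbig⟩ : ∃ Abig : Set (EuclideanSpace ℝ (Fin 4)),
        Abig = Metric.ball 0 (rc i) \ Metric.closedBall 0 ε := ⟨_, rfl⟩
    rw [← hAbig] at hΦs hopen hmf hfib hρs hdesc hcmp hRb
    obtain ⟨A', hA'⟩ : ∃ A' : Set (EuclideanSpace ℝ (Fin 4)),
        A' = Metric.ball 0 r₁ \ Metric.closedBall 0 ε := ⟨_, rfl⟩
    have hA'sub : A' ⊆ Abig := by
      rw [hA', hAbig]; exact Set.sdiff_subset_sdiff_left (Metric.ball_subset_ball hr₁r.le)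
    have hmemA' : ∀ {y : EuclideanSpace ℝ (Fin 4)}, y ∈ A' ↔ ε < ‖y‖ ∧ ‖y‖ < r₁ := by
      intro y
      simp only [hA', Set.mem_sdiff, Metric.mem_ball, dist_zero_right, Metric.mem_closedBall, not_le]
      tauto
    have hmemAbig : ∀ {y : EuclideanSpace ℝ (Fin 4)}, y ∈ Abig ↔ ε < ‖y‖ ∧ ‖y‖ < rc i := by
      intro y
      simp only [hAbig, Set.mem_sdiff, Metric.mem_ball, dist_zero_right, Metric.mem_closedBall, not_le]
      tauto
    -- fibres over `A'` stay in `A'`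
    have hfibre : ∀ y ∈ A', ∀ y' ∈ Abig, Φ y' = Φ y → y' ∈ A' := by
      intro y hy y' hy' hyy
      have h1 : ‖y'‖ ^ 2 = ‖y‖ ^ 2 := by rw [← hdesc y' hy', ← hdesc y (hA'sub hy), hyy]
      have h2 : ‖y'‖ = ‖y‖ := by
        rcases abs_eq_abs.mp ((sq_eq_sq_iff_abs_eq_abs _ _).mp h1) with h | h
        · exact h
        · linarith only [h, norm_nonneg y, norm_nonneg y']
      rw [hmemA', h2]; exact hmemA'.mp hy
    -- the image `Φ A'` is open
    have hopen' : IsOpen (Φ '' A') := by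
      have heq : Φ '' A' = Φ '' Abig ∩ ρ ⁻¹' Set.Iio (r₁ ^ 2) := by
        ext x
        constructor
        · rintro ⟨y, hy, rfl⟩
          refine ⟨mem_image_of_mem Φ (hA'sub hy), ?_⟩
          rw [Set.mem_preimage, hdesc y (hA'sub hy), Set.mem_Iio]
          have h0 := norm_nonneg y
          have h1 := (hmemA'.mp hy).2
          nlinarith only [h0, h1]
        · rintro ⟨⟨y, hy, rfl⟩, hlt⟩
          rw [Set.mem_preimage, hdesc y hy, Set.mem_Iio] at hlt
          refine mem_image_of_mem Φ ?_
          rw [hmemA']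
          refine ⟨(hmemAbig.mp hy).1, ?_⟩
          by_contra hge
          rw [not_lt] at hge
          nlinarith only [hlt, hge, hr₁]
      rw [heq]
      exact hρs.continuousOn.isOpen_inter_preimage hopen isOpen_Iio
    -- the rescaled slice `h = Q g_k(t)`
    have hgR : (gk kₓ t).IsRiemannian := hRiem kₓ t ht
    have hhR : ((gk kₓ t).constSmul Q hQ.ne').IsRiemannian := hgR.constSmul hQ
    have hRg : ContMDiff (𝓡 4) 𝓘(ℝ, ℝ) ∞ (fun x ↦ (gk kₓ t).scalarCurvatureWith (covk kₓ t) x) :=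
      contMDiff_scalarCurvatureWith_holds (𝓡 4) M (gk kₓ t) (covk kₓ t) ((hflow kₓ).isLeviCivita t ht)
    have hRh : Continuous fun x ↦ ((gk kₓ t).constSmul Q hQ.ne').scalarCurvatureWith (covk kₓ t) x := by
      have heq : (fun x ↦ ((gk kₓ t).constSmul Q hQ.ne').scalarCurvatureWith (covk kₓ t) x) =
          fun x ↦ Q⁻¹ * (gk kₓ t).scalarCurvatureWith (covk kₓ t) x :=
        funext fun x ↦ (gk kₓ t).scalarCurvatureWith_constSmul Q hQ.ne' (covk kₓ t) x
      rw [heq]; exact continuous_const.mul hRg.continuous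
    -- the floor on the rescaled slice
    have hfloor_h : (m : EReal) ≤ ((gk kₓ t).constSmul Q hQ.ne').muEntropy (covk kₓ t) τ := by
      rw [(gk kₓ t).muEntropy_constSmul' (covk kₓ t) hQ hτpos, hm]
      exact hfloor kₓ t ht (τ / Q) (div_pos hτpos hQ)
    -- the two metric comparisons, restated in this file's vocabulary
    have hgcmp₀ : ∀ y ∈ Metric.ball (0 : EuclideanSpace ℝ (Fin 4)) r₁, ∀ v : EuclideanSpace ℝ (Fin 4),
        (1 - η / 3) * ‖v‖ ^ 2 ≤ gc i y v v ∧ gc i y v v ≤ (1 + η / 3) * ‖v‖ ^ 2 := hgcmp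
    have hcmp₀ : ∀ y ∈ Abig, ∀ v : EuclideanSpace ℝ (Fin 4),
        (1 - η / 3) * gc i y v v ≤
            Q * (gk kₓ t).val (Φ y) (mfderiv (𝓡 4) (𝓡 4) Φ y v) (mfderiv (𝓡 4) (𝓡 4) Φ y v) ∧
          Q * (gk kₓ t).val (Φ y) (mfderiv (𝓡 4) (𝓡 4) Φ y v) (mfderiv (𝓡 4) (𝓡 4) Φ y v) ≤
            (1 + η / 3) * gc i y v v := hcmp
    -- the comparison for `h` on `A'`
    have hcomp' : ∀ y ∈ A', ∀ v : EuclideanSpace ℝ (Fin 4),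
        (1 - η) * ‖v‖ ^ 2 ≤ ((gk kₓ t).constSmul Q hQ.ne').val (Φ y) (mfderiv (𝓡 4) (𝓡 4) Φ y v)
          (mfderiv (𝓡 4) (𝓡 4) Φ y v) ∧
        ((gk kₓ t).constSmul Q hQ.ne').val (Φ y) (mfderiv (𝓡 4) (𝓡 4) Φ y v)
          (mfderiv (𝓡 4) (𝓡 4) Φ y v) ≤ (1 + η) * ‖v‖ ^ 2 := by
      intro y hy v
      have hyb : y ∈ Metric.ball (0 : EuclideanSpace ℝ (Fin 4)) r₁ := by
        rw [Metric.mem_ball, dist_zero_right]; exact (hmemA'.mp hy).2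
      obtain ⟨hc1, hc2⟩ := hgcmp₀ y hyb v
      obtain ⟨ht1, ht2⟩ := hcmp₀ y (hA'sub hy) v
      rw [(gk kₓ t).constSmul_apply]
      have hv0 : 0 ≤ ‖v‖ ^ 2 := sq_nonneg _
      have hθ1 : 0 ≤ 1 - η / 3 := by linarith only [hη1]
      constructor
      · have e1 : (1 - η) * ‖v‖ ^ 2 ≤ (1 - η / 3) * ((1 - η / 3) * ‖v‖ ^ 2) := by
          have key : (1 - η / 3) * ((1 - η / 3) * ‖v‖ ^ 2) - (1 - η) * ‖v‖ ^ 2 =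
              (η / 3 + η ^ 2 / 9) * ‖v‖ ^ 2 := by ring
          have : 0 ≤ (η / 3 + η ^ 2 / 9) * ‖v‖ ^ 2 := by positivity
          linarith only [key, this]
        have e2 : (1 - η / 3) * ((1 - η / 3) * ‖v‖ ^ 2) ≤ (1 - η / 3) * gc i y v v :=
          mul_le_mul_of_nonneg_left hc1 hθ1
        exact e1.trans (e2.trans ht1)
      · have e2 : (1 + η / 3) * gc i y v v ≤ (1 + η / 3) * ((1 + η / 3) * ‖v‖ ^ 2) :=
          mul_le_mul_of_nonneg_left hc2 (by linarith only [hηpos])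
        have e3 : (1 + η / 3) * ((1 + η / 3) * ‖v‖ ^ 2) ≤ (1 + η) * ‖v‖ ^ 2 := by
          have key : (1 + η) * ‖v‖ ^ 2 - (1 + η / 3) * ((1 + η / 3) * ‖v‖ ^ 2) =
              η / 9 * (3 - η) * ‖v‖ ^ 2 := by ring
          have : 0 ≤ η / 9 * (3 - η) * ‖v‖ ^ 2 :=
            mul_nonneg (mul_nonneg (by positivity) (by linarith only [hη1])) hv0
          linarith only [key, this]
        exact ht2.trans (e2.trans e3)
    -- scalar curvature of `h` on `Φ A'`
    have hRΛ' : ∀ y ∈ A', |((gk kₓ t).constSmul Q hQ.ne').scalarCurvatureWith (covk kₓ t) (Φ y)| ≤ Λc i := by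
      intro y hy
      rw [(gk kₓ t).scalarCurvatureWith_constSmul Q hQ.ne' (covk kₓ t), abs_mul, abs_inv, abs_of_pos hQ,
        inv_mul_le_iff₀ hQ]
      exact hRb y (hA'sub hy)
    -- fibres and the arithmetic
    have hfib' : ∀ y ∈ A', (Φ ⁻¹' {Φ y} ∩ A').ncard = kc i := by
      intro y hy
      have heq : Φ ⁻¹' {Φ y} ∩ A' = Φ ⁻¹' {Φ y} ∩ Abig := by
        ext y'
        constructor
        · rintro ⟨h1, h2⟩; exact ⟨h1, hA'sub h2⟩
        · rintro ⟨h1, h2⟩; exact ⟨h1, hfibre y hy y' h2 h1⟩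
      rw [heq]; exact hfib y (hA'sub hy)
    have harith' := harith η τ (Λc i) ε r₁ hηpos.le hηle hτpos hΛnn hΛτ hεpos hεsq hr₁ hτ2
    rw [hA'] at hopen' hfib' hcomp' hRΛ' hA'sub
    -- per-piece volume comparison on injective pieces (landed `stub_injOnVolumeComparison`)
    have hper : ∀ U ⊆ Metric.ball (0 : EuclideanSpace ℝ (Fin 4)) r₁ \ Metric.closedBall 0 ε, IsOpen U →
        Set.InjOn Φ U → ∀ S ⊆ U, MeasurableSet S →
          ENNReal.ofReal ((1 - η) ^ 2) * volume S ≤ ((gk kₓ t).constSmul Q hQ.ne').riemVolume (Φ '' S) ∧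
            ((gk kₓ t).constSmul Q hQ.ne').riemVolume (Φ '' S) ≤ ENNReal.ofReal ((1 + η) ^ 2) * volume S :=
      fun U hUA hUo hinjU S hSU hS ↦
        stub_injOnVolumeComparison M _ hhR Φ U η hηpos.le hη1 hUo (hΦs.mono (hUA.trans hA'sub)) hinjU
          (fun y hy v ↦ hcomp' y (hUA hy) v) S hSU hS
    have hlt := coneCore M ((gk kₓ t).constSmul Q hQ.ne') hhR (covk kₓ t) hRh (kc i) hk1
      m η τ (Λc i) ε r₁ hη1 hτpos hεpos hr₁ hεr₁' Φ ρ (hΦs.mono hA'sub) hopen'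
      (fun y hy ↦ hmf y (hA'sub hy)) hfib' (hρs.mono (image_mono hA'sub))
      (fun y hy ↦ hdesc y (hA'sub hy)) (fun y hy v ↦ (hcomp' y hy v).1) hRΛ' hper harith'
    exact absurd hfloor_h (not_le.mpr hlt)
  · -- ### no cone point: the export is the complete smooth shrinker
    haveI hιe : IsEmpty ι := not_nonempty_iff.mp hι
    haveI : ConnectedSpace S := hconn hιe
    have hRpos : ∀ x : S, 0 < gS.scalarCurvature x := hdich.resolve_right hι
    obtain ⟨fS, hfS, hsolS, hnormS, hnonflat, hdens⟩ :=
      stub_renormalise S gS f hS W δ' hδ' hf hsol hnorm hprob hFW hRpos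
    exact ⟨S, i1, i2, i3, i4, i5, inferInstance, i7, i8, i9, gS, iLC, fS, hS, hcompl hιe, hfS, hsolS, hnormS,
      hnonflat, hdens, fun hSc ↦ hcouple hιe hSc⟩

/-- **The blow-up sequence, from F1 and F2** (the line's `stub_blowupSequence`): from a closed connected
`(M, g)` with `R > 0` and the floor `μ(g, τ) ≥ ν_cyl + δ`, the maximal Ricci flow (F1; finite singular time,
curvature blow-up), Perelman's floor along it (F2), point picking and parabolic rescaling give flows on
`M × [-A_k, 0]`, `A_k ≥ k`, `|Rm| ≤ 1`, a non-flat anchor, `κ`-noncollapsing and the floor.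
[cite: Perelman2002, §4, Thm. 4.1] -/
theorem blowupSequence_of (hF1 : ricciFlow_shortTime_existence.{0, 0, 0})
    (hF2 : perelman_muEntropy_monotone.{0, 0, 0}) :
    ∀ (M : Type) [TopologicalSpace M] [T2Space M] [SecondCountableTopology M]
      [ChartedSpace (EuclideanSpace ℝ (Fin 4)) M] [IsManifold (𝓡 4) ∞ M] [CompactSpace M]
      [ConnectedSpace M] [T3Space M] [MeasurableSpace M] [BorelSpace M]
      (g : PseudoRiemannianMetric (𝓡 4) ∞ (EuclideanSpace ℝ (Fin 4)) (TangentSpace (𝓡 4) : M → Type _))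
      [g.HasLeviCivita] (hg : g.IsRiemannian),
      (∀ x : M, 0 < g.scalarCurvature x) →
      (∃ δ : ℝ, 0 < δ ∧ ∀ τ : ℝ, 0 < τ → ∀ f : M → ℝ, ContMDiff (𝓡 4) 𝓘(ℝ, ℝ) ∞ f →
        ∫ x, (4 * Real.pi * τ) ^ (-(4 : ℝ) / 2) * Real.exp (-f x)
          ∂(riemannianMeasure (g.toContMDiffRiemannianMetric hg)) = 1 →
        Real.log 2 + Real.log Real.pi / 2 - 3 / 2 + δ ≤
          ∫ x, (τ * (g.scalarCurvature x + g.gradSq f x) + f x - 4) *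
            ((4 * Real.pi * τ) ^ (-(4 : ℝ) / 2) * Real.exp (-f x))
            ∂(riemannianMeasure (g.toContMDiffRiemannianMetric hg))) →
      ∃ (κ δ' c : ℝ), 0 < κ ∧ 0 < δ' ∧ 0 < c ∧
        ∃ (A : ℕ → ℝ)
          (gk : ℕ → ℝ → PseudoRiemannianMetric (𝓡 4) ∞ (EuclideanSpace ℝ (Fin 4)) (TangentSpace (𝓡 4) : M → Type _))
          (covk : ℕ → ℝ → CovariantDerivative (𝓡 4) (EuclideanSpace ℝ (Fin 4)) (TangentSpace (𝓡 4) : M → Type _))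
          (xk : ℕ → M),
          (∀ k : ℕ, (k : ℝ) ≤ A k) ∧
          (∀ k, IsRicciFlow (gk k) (covk k) (Set.Icc (-(A k)) 0)) ∧
          (∀ k, ∀ t ∈ Set.Icc (-(A k)) 0, (gk k t).IsRiemannian) ∧
          (∀ k, ∀ t ∈ Set.Icc (-(A k)) 0, CurvatureBoundedBy (gk k t) (covk k t) 1) ∧
          (∀ k, ∃ X Y Z W : TangentSpace (𝓡 4) (xk k),
            (gk k 0).val (xk k) X X ≤ 1 ∧ (gk k 0).val (xk k) Y Y ≤ 1 ∧
            (gk k 0).val (xk k) Z Z ≤ 1 ∧ (gk k 0).val (xk k) W W ≤ 1 ∧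
            c ≤ |(gk k 0).curvatureForm (covk k 0) (xk k) X Y Z W|) ∧
          (∀ k, ∀ r₀ : ℝ, 0 < r₀ → r₀ < Real.sqrt (A k) →
            IsKappaNoncollapsed (gk k) (covk k) (Set.Icc (-(A k)) 0) κ r₀) ∧
          (∀ k, ∀ t ∈ Set.Icc (-(A k)) 0, ∀ τ : ℝ, 0 < τ →
            ((Real.log 2 + Real.log Real.pi / 2 - 3 / 2 + δ' : ℝ) : EReal) ≤
              (gk k t).muEntropy (covk k t) τ) := by
  intro M _ _ _ _ _ _ _ _ _ _ g _ hg hR hν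
  obtain ⟨δ, hδ, hfloor⟩ := hν
  -- the singular flow with blow-up, NLC and the floor (F1, F2)
  obtain ⟨T, κ, hκ, gt, cov, hmax, _h0, hblow, hnc, hfl⟩ :=
    stub_singularFlow_of hF1 hF2 M g hg hR δ hδ hfloor
  -- point picking
  obtain ⟨tk, Qk, xk, htk, hQk, hA, hbd, hpick⟩ := stub_pointPicking M T gt cov hmax hblow
  -- parabolic rescaling
  exact stub_rescaledSequence M T δ κ hδ hκ gt cov hmax hnc hfl tk Qk xk htk hQk hA hbd hpick

/-- **RUNG from the two gaps, conditionally on F1, F2, N1**: `SubcylindricalRecognition` follows from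
`NoncompactShrinkerGap` and `CompactShrinkerGap`. Blow up (`blowupSequence_of`) and blow down
(`blowdown_of`); a non-compact blow-down contradicts `NoncompactShrinkerGap` (Gaussian mass `> Θ_cyl`
versus `≤ Θ_cyl`); a compact one immerses injectively into the connected `M`, hence
(`stub_compactModelRecognition`) is diffeomorphic to `M ≃ₕ S⁴`, and `CompactShrinkerGap` returns its
diffeomorphism to `S⁴`. [cite: Bamler2020Structure, §2.7 Thm 2.40] -/
theorem subcylindricalRecognition_of_facts (hF1 : ricciFlow_shortTime_existence.{0, 0, 0})
    (hF2 : perelman_muEntropy_monotone.{0, 0, 0}) (hN1 : bamler_orbifoldTangentFlowAtInfinity_four)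
    (h₂ : _root_.Summit.SmoothPoincare4.SmoothPoincare4.Theses.EntropyRung.NoncompactShrinkerGap)
    (h₄ : _root_.Summit.SmoothPoincare4.SmoothPoincare4.Theses.EntropyRung.CompactShrinkerGap) :
    _root_.Summit.SmoothPoincare4.SmoothPoincare4.Theses.EntropyRung.SubcylindricalRecognition := by
  intro M _ _ _ _ _ _ _ _ _ e g _ hg hR hν
  -- `M ≃ₕ S⁴` ⇒ `M` (path) connected
  haveI : PathConnectedSpace (Metric.sphere (0 : EuclideanSpace ℝ (Fin 5)) 1) :=
    Literature.Topology.FourManifolds.pathConnectedSpace_sphere_four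
  haveI : PathConnectedSpace M :=
    Literature.Topology.FourManifolds.pathConnectedSpace_of_homotopyEquiv e
  -- the blow-up sequence of rescaled flows on `M`
  obtain ⟨κ, δ', c, _hκ, hδ', hc, A, gk, covk, xk, hA, hflow, hRiem, hcurv, hpt, _hnc, hfloor⟩ :=
    blowupSequence_of hF1 hF2 M g hg hR hν
  -- its blow-down shrinker `S`
  obtain ⟨S, _, _, _, _, _, _, _, _, _, gS, _, fS, hS, hScomplete, hfS, hsol, hnorm, hSnonflat, hdens,
      hScouple⟩ :=
    blowdown_of hN1 M A gk covk xk δ' c hδ' hc hA hflow hRiem hcurv hpt hfloor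
  by_cases hSc : CompactSpace S
  · -- compact blow-down: `S` immerses injectively into `M`, hence `S ≅ M ≃ₕ S⁴`,
    -- and `CompactShrinkerGap` applies to `S`
    obtain ⟨φ, hφ, hφinj, hφimm⟩ := hScouple hSc
    obtain ⟨eSM⟩ := stub_compactModelRecognition S M φ hφ hφinj hφimm
    have eS4 : S ≃ₕ Metric.sphere (0 : EuclideanSpace ℝ (Fin 5)) 1 :=
      eSM.toHomeomorph.toHomotopyEquiv.trans e
    obtain ⟨eS⟩ := h₄ S eS4 gS fS hS hfS hsol hnorm hdens
    exact ⟨eSM.symm.trans eS⟩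
  · -- non-compact blow-down: forbidden by `NoncompactShrinkerGap`
    haveI : NoncompactSpace S := not_compactSpace_iff.mp hSc
    have hle := h₂ S gS fS hS hScomplete hfS hsol hnorm hSnonflat
    exact absurd hdens (not_lt.mpr hle)

end RecognitionOfShrinkerGaps

/-- **`RecognitionOfShrinkerGaps` (stmt-SmoothPoincare4-14742), conditionally on F1, F2, N1**: the two
shrinker density gaps imply the rung, `NoncompactShrinkerGap → CompactShrinkerGap →
SubcylindricalRecognition` — the Perelman–Bamler reduction, modulo Hamilton's short-time existence (F1),
Perelman's `μ`-monotonicity (F2) and Bamler's tangent flow at `-∞` (N1), all named facts of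
Literature/Geometry/Riemannian without `_holds`. [cite: Perelman2002, §4, Thm. 4.1]
[cite: Bamler2020Structure, §2.7 Thm 2.40; §2.10 Thm 2.46] -/
theorem recognitionOfShrinkerGaps_of_facts (hF1 : ricciFlow_shortTime_existence.{0, 0, 0})
    (hF2 : perelman_muEntropy_monotone.{0, 0, 0}) (hN1 : bamler_orbifoldTangentFlowAtInfinity_four) :
    _root_.Summit.SmoothPoincare4.SmoothPoincare4.Theses.EntropyRung.RecognitionOfShrinkerGaps :=
  fun h₂ h₄ ↦ RecognitionOfShrinkerGaps.subcylindricalRecognition_of_facts hF1 hF2 hN1 h₂ h₄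

end Summit.SmoothPoincare4.SmoothPoincare4.Theorems

end
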